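import Summits.MatrixMultiplication.MatrixMultiplication.Theorems.FidelityWitnessesLinearDefectLawUnitSlope
import Summits.MatrixMultiplication.MatrixMultiplication.Theorems.FidelityWitnessesLinearDefectLawStubUnusedDirection
import Summits.MatrixMultiplication.MatrixMultiplication.Theorems.FidelityWitnessesLinearDefectLawStubCriticalGram
import Summits.MatrixMultiplication.MatrixMultiplication.Theorems.FidelityWitnessesLinearDefectLawStubPassage

/-!
# `FidelityWitnesses.LinearDefectLaw` (stmt-MatrixMultiplication-14039), line `border-singular-values` — III: the REDUCTION to the core

Third reduction file (imports `…LinearDefectLawUnitSlope`). The crux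
`LinearDefectLaw : ∀ n r S, tensorRank S ≤ r → |⟨S,⟨n,n,n⟩⟩|² ≤ (n³ + r − R̲(⟨n,n,n⟩))·‖S‖²` follows from ONE remaining statement, the
line's open core `Core` (registered stub `stub_core` of the crux item, stated raw below as a named hypothesis): at a CONCISE optimal-scale
fidelity maximiser `S` of the closed cone `closure {rank ≤ r}` in the window `2n ≤ r < R̲`, given the critical Gram identity, some unit
triad sees a full unit of `T − S`. Composition: `Core` + `UnusedDirection.stub_unusedDirection` (p86623) + `CriticalGram.stub_criticalGram`
(p86991) ⇒ the residual spectral law `RSL` at exact maximisers on the window (`rsl_of_core`); `Passage.stub_passage` (p86920) ⇒ its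
δ-optimal honest form (`spectralResidual_raw`); the unit-slope glue of file II ⇒ `linearDefectLaw_of_core : Core → LinearDefectLaw`.
Nothing is claimed unconditionally about the crux; the theorem is CONDITIONAL on `Core` by design (it records the reduction).
-/

noncomputable section

namespace Summit.MatrixMultiplication.MatrixMultiplication.Theorems.LinearDefectLaw.Reduction

open scoped BigOperators ComplexConjugate
open Literature.Computability.AlgebraicComplexity
open Summit.MatrixMultiplication.MatrixMultiplication.Theses.FidelityWitnesses (LinearDefectLaw)
open Summit.MatrixMultiplication.MatrixMultiplication.Theorems

set_option linter.dupNamespace false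

/-! ### The reshaped S3 (lead, reshapes r1/r2): `S3 = passage ∘ (criticalGram, unusedDirection, Core)`

`spectralResidual_raw` (S3, δ-optimal honest form, window `2n ≤ r`) is proved from the hypothesis `Core` and three LANDED stubs:
`Passage.stub_passage` (compactness: the exact-maximiser law `RSL(n,r)` implies S3 at level `(n,r)`),
`CriticalGram.stub_criticalGram` (first-order optimality under `GL(n²)³` at maximisers of the closed cone),
`UnusedDirection.stub_unusedDirection` (a rank-one matrix killing `S` in some mode exhibits a unit triad on which `T − S` is `1`).
Composition: `rsl_of_core` (case split on the unused direction) and `spectralResidual_raw := stub_passage _ _ (rsl_of_core …)`. -/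




/-- **`Core` — the line's ONE open statement (registered stub `stub_core` of stmt-MatrixMultiplication-14039): unit residual at
CONCISE critical maximisers in the window `2n ≤ r < R̲`.**
In the window `2n ≤ r < R̲(⟨n,n,n⟩)` (reshape r2: the rung `r = 2n − 1` is now FREE, `stub_freeUnitProductDet`), let `S` be a
nonzero optimal-scale fidelity maximiser of the closed cone
`closure {rank ≤ r}` (so `S ≠ T` by Alder–Strassen, `T − S ⟂ S`, `‖T − S‖² = n³ − M(n,r) > 0`), satisfying the critical Gram
identity `S_(p)T_(p)^* = S_(p)S_(p)^*` in all three modes (supplied by `stub_criticalGram`) and CONCISE: no rank-one matrix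
kills `S` in any mode (the non-concise case is `stub_unusedDirection`). Then some unit triad sees a full unit of the residual:
`|Σ (T − S) x y z| ≥ 1`, i.e. `‖T − S‖_σ ≥ 1 = ‖T‖_σ`. This is RSL/URL/SpectralResidual of the three cards restricted to the
stratum where the crux is analog-hard; what the hypotheses give: `K_p := S_(p)T_(p)^*/n` Hermitian, `0 ⪯ K_p ⪯ I`,
`(T−S)_(p)(T−S)_(p)^* = n(I − K_p)`, `‖T − S‖² = n·tr(I − K_p)`, `rank K_p ≥ n² − 2n + 2`; evidence: margins `1.004982` (2,3),
`[1.0618, 1.0740]` (2,4), `1⁺` (2,5), `1` (2,6), `≥ 1` at every computed `n = 3` optimum incl. Smirnov-seeded window points;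
at `(2,6)` it implies `SevenEighthsLaw` (stmt-4959). Candidate mechanisms (none proved): coverage/nodal form (some rotated
unit product `t` with `Re⟨S,t⟩ ≤ 0`; `T = n³·𝔼_t t` so `𝔼_t ⟨t, T − S⟩ = ‖T − S‖²/n³`), max-vs-mean on `K_T`-orbits,
second-order optimality. WHY IT MIGHT FAIL: a concise maximiser at `n ≥ 3` in `[2n² − n, R̲)` with a diffuse residual. -/
def Core : Prop :=
    ∀ (n r : ℕ) (S : Fin n × Fin n → Fin n × Fin n → Fin n × Fin n → ℂ),
      2 * n ≤ r → r < algBorderRank (matMulTensor ℂ n n n) →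
      S ∈ closure {S' : Fin n × Fin n → Fin n × Fin n → Fin n × Fin n → ℂ | tensorRank S' ≤ r} → S ≠ 0 →
      (∑ a, ∑ b, ∑ c, S a b c * matMulTensor ℂ n n n a b c) = ((∑ a, ∑ b, ∑ c, ‖S a b c‖ ^ 2 : ℝ) : ℂ) →
      (∀ S' : Fin n × Fin n → Fin n × Fin n → Fin n × Fin n → ℂ, tensorRank S' ≤ r →
        ‖∑ a, ∑ b, ∑ c, S' a b c * matMulTensor ℂ n n n a b c‖ ^ 2 ≤
          (∑ a, ∑ b, ∑ c, ‖S a b c‖ ^ 2) * ∑ a, ∑ b, ∑ c, ‖S' a b c‖ ^ 2) →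
      ((∀ a a' : Fin n × Fin n, (∑ b, ∑ c, S a b c * (starRingEnd ℂ) (matMulTensor ℂ n n n a' b c)) =
          ∑ b, ∑ c, S a b c * (starRingEnd ℂ) (S a' b c)) ∧
        (∀ b b' : Fin n × Fin n, (∑ a, ∑ c, S a b c * (starRingEnd ℂ) (matMulTensor ℂ n n n a b' c)) =
          ∑ a, ∑ c, S a b c * (starRingEnd ℂ) (S a b' c)) ∧
        (∀ c c' : Fin n × Fin n, (∑ a, ∑ b, S a b c * (starRingEnd ℂ) (matMulTensor ℂ n n n a b c')) =
          ∑ a, ∑ b, S a b c * (starRingEnd ℂ) (S a b c'))) →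
      ¬ ((∃ u v : Fin n → ℂ, u ≠ 0 ∧ v ≠ 0 ∧
            ∀ b c : Fin n × Fin n, (∑ a : Fin n × Fin n, (starRingEnd ℂ) (u a.1) * v a.2 * S a b c) = 0) ∨
          (∃ u v : Fin n → ℂ, u ≠ 0 ∧ v ≠ 0 ∧
            ∀ a c : Fin n × Fin n, (∑ b : Fin n × Fin n, (starRingEnd ℂ) (u b.1) * v b.2 * S a b c) = 0) ∨
          (∃ u v : Fin n → ℂ, u ≠ 0 ∧ v ≠ 0 ∧
            ∀ a b : Fin n × Fin n, (∑ c : Fin n × Fin n, (starRingEnd ℂ) (u c.1) * v c.2 * S a b c) = 0)) →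
      ∃ x y z : Fin n × Fin n → ℂ, (∑ i, ‖x i‖ ^ 2) = 1 ∧ (∑ i, ‖y i‖ ^ 2) = 1 ∧ (∑ i, ‖z i‖ ^ 2) = 1 ∧
        1 ≤ ‖∑ a, ∑ b, ∑ c, (matMulTensor ℂ n n n a b c - S a b c) * x a * y b * z c‖


/-! ### Vocabulary for the reshaped S3 and its composition (proved) -/

/-- `S` is a nonzero optimal-scale fidelity MAXIMISER of level `r`: a point of the closed cone `closure {rank ≤ r}` with
`Σ S·T = Σ‖S‖²` whose fidelity `normSq S` bounds that of every honest rank-`≤ r` tensor. -/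
def IsMaximiser (n r : ℕ) (S : P n → P n → P n → ℂ) : Prop :=
  S ∈ closure {S' : P n → P n → P n → ℂ | tensorRank S' ≤ r} ∧ S ≠ 0 ∧
    overlap S = ((normSq S : ℝ) : ℂ) ∧
    ∀ S' : P n → P n → P n → ℂ, tensorRank S' ≤ r → ‖overlap S'‖ ^ 2 ≤ normSq S * normSq S'

/-- a UNIT WITNESS for `T − S`: a unit triad on which the plain residual evaluates to modulus `≥ 1` (`‖T − S‖_σ ≥ 1`). -/
def UnitWitness (n : ℕ) (S : P n → P n → P n → ℂ) : Prop :=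
  ∃ x y z : P n → ℂ, IsUnitVec x ∧ IsUnitVec y ∧ IsUnitVec z ∧
    1 ≤ ‖triEval (fun a b c => matMulTensor ℂ n n n a b c - S a b c) x y z‖

/-- the critical Gram identity `S_(p)T_(p)^* = S_(p)S_(p)^*` in the three modes (card ccnf L1). -/
def CriticalGram {n : ℕ} (S : P n → P n → P n → ℂ) : Prop :=
  (∀ a a' : P n, (∑ b, ∑ c, S a b c * conj (matMulTensor ℂ n n n a' b c)) = ∑ b, ∑ c, S a b c * conj (S a' b c)) ∧
    (∀ b b' : P n, (∑ a, ∑ c, S a b c * conj (matMulTensor ℂ n n n a b' c)) = ∑ a, ∑ c, S a b c * conj (S a b' c)) ∧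
    (∀ c c' : P n, (∑ a, ∑ b, S a b c * conj (matMulTensor ℂ n n n a b c')) = ∑ a, ∑ b, S a b c * conj (S a b c'))

/-- some mode of `S` is killed by a rank-one matrix `η = u v^*` (an UNUSED rank-one DIRECTION; card ccnf). -/
def HasUnusedDirection {n : ℕ} (S : P n → P n → P n → ℂ) : Prop :=
  (∃ u v : Fin n → ℂ, u ≠ 0 ∧ v ≠ 0 ∧ ∀ b c : P n, (∑ a : P n, conj (u a.1) * v a.2 * S a b c) = 0) ∨
    (∃ u v : Fin n → ℂ, u ≠ 0 ∧ v ≠ 0 ∧ ∀ a c : P n, (∑ b : P n, conj (u b.1) * v b.2 * S a b c) = 0) ∨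
    (∃ u v : Fin n → ℂ, u ≠ 0 ∧ v ≠ 0 ∧ ∀ a b : P n, (∑ c : P n, conj (u c.1) * v c.2 * S a b c) = 0)

/-- the exact-maximiser RESIDUAL SPECTRAL LAW at level `(n, r)`: every maximiser has a unit witness. -/
def RSL (n r : ℕ) : Prop := ∀ S : P n → P n → P n → ℂ, IsMaximiser n r S → UnitWitness n S

/-- S3a in vocabulary form. -/
theorem unitWitness_of_hasUnusedDirection {n : ℕ} (S : P n → P n → P n → ℂ) (h : HasUnusedDirection S) :
    UnitWitness n S :=
  Summit.MatrixMultiplication.MatrixMultiplication.Theorems.LinearDefectLaw.UnusedDirection.stub_unusedDirection n S h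

/-- S3b in vocabulary form. -/
theorem criticalGram_of_isMaximiser {n r : ℕ} (S : P n → P n → P n → ℂ) (h : IsMaximiser n r S) :
    CriticalGram S :=
  Summit.MatrixMultiplication.MatrixMultiplication.Theorems.LinearDefectLaw.CriticalGram.stub_criticalGram n r S h.1 h.2.1 h.2.2.1 h.2.2.2

/-- S3d in vocabulary form. -/
theorem unitWitness_of_concise (hcore : Core) {n r : ℕ} (hw : 2 * n ≤ r)
    (hb : r < algBorderRank (matMulTensor ℂ n n n))
    (S : P n → P n → P n → ℂ) (h : IsMaximiser n r S) (hc : CriticalGram S) (hu : ¬ HasUnusedDirection S) :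
    UnitWitness n S :=
  hcore n r S hw hb h.1 h.2.1 h.2.2.1 h.2.2.2 hc hu

/-- **RSL on the window from the stubs** (case split: unused rank-one direction, or concise). -/
theorem rsl_of_core (hcore : Core) {n r : ℕ} (hw : 2 * n ≤ r)
    (hb : r < algBorderRank (matMulTensor ℂ n n n)) : RSL n r := by
  intro S hS
  by_cases hu : HasUnusedDirection S
  · exact unitWitness_of_hasUnusedDirection S hu
  · exact unitWitness_of_concise hcore hw hb S hS (criticalGram_of_isMaximiser S hS) hu

/-- **S3 — `SpectralResidual` on the window (the idea's lever)**, PROVED from the reshape-r1 stubs via `stub_passage`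
(no longer a registered stub). For `2n − 1 ≤ r < R̲(⟨n,n,n⟩)` and every `ε > 0` there is `δ > 0` such that every NONZERO rank-`≤ r`
tensor `S` that is `δ`-optimal for the fidelity among rank-`≤ r` tensors leaves a residual `resid S = T − P_{ℂS}T` of
spectral norm² `≥ 1 − ε`: some unit triad `(x,y,z)` has `|resid S (x,y,z)|² ≥ 1 − ε` ("what is still missing always
contains one whole unit triad"; by compactness of the projectivised problem this is EQUIVALENT to: every nearest point
`S_r ≠ T` of the closed cone `σ̂_r` — border limits included — has `‖T − S_r‖_σ ≥ 1`, the URL/RSL of the two sibling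
cards). The `δ`-optimal HONEST form needs no closure / Alder–Strassen bookkeeping and covers non-attained suprema
(`(2,5)`: Bini, `LinearDefectLawNeg.linearDefectLaw_tight_two_five`).
WHY PLAUSIBLY TRUE. (a) It is the exact tensor shadow of the matrix fact behind the crux's heuristic
(Eckart–Young–Mirsky for a matrix with unit singular values: the best rank-`k` residual has operator norm
`σ_{k+1} = 1`); `T` is nuclear-flat (`‖T‖_σ = 1`, nuclear norm `n³ = ‖T‖²`, Derksen2015) and every partial matrix
multiplication has spectral norm exactly `1`. (b) EQUALITY exactly where the crux is tight: `(2,6)` `resid = a₂₂b₂₂c₂₂`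
(`linearDefectLaw_tight_two_six`), `(2,5)` `resid →` Bini pair `x₂₁y₁₂z₂₂ + x₂₂y₂₂z₂₂` (`‖·‖_σ = 1 < √2 = ‖·‖_F`), and
slack where the crux has slack. (c) NUMBERS (four independent codes, incl. pure-Lean `Float` replication by triage
r1-3 and two-sided brackets by r1-1/r1-2): `‖resid‖_σ` at the optima `= 1.004982 ∈ [1.00498, 1.41]` at `(2,3)`,
`∈ [1.0618, 1.0740]` at `(2,4)`, `∈ [1.00006, 1.00011]` at `(2,5)`, `= 1` at `(2,6)`; `n = 3`: `≥ 1` at all 17 levels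
`r = 2…18` of the ideator's scan (kit j010470; local optima for `r ≳ 14`) AND at the Smirnov-seeded window points of
triage r1-1 (kit j012293 C: `r = 19`: `[1.154, 1.201]` at `d₁₉ ≤ 2.330`; `r = 18`: `[1.00004, 1.0004]`; `r = 17`:
`[1.0002, 1.0029]`; `r = 16`: `[1.002, 1.415]`); 21 rectangular rungs of `⟨2,2,3⟩, ⟨2,3,3⟩, ⟨2,2,4⟩` (j012315)
never below `1`. (d) What a proof can hold on to at an exact optimum / nearest point `S_r` (entry lemmas, all
provable now, filed `--supports` by whoever proves S3): `resid ⟂` Terracini space (`E(·,v_l,w_l) = E(u_l,·,w_l) =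
E(u_l,v_l,·) = 0`: `S_r` reproduces the products of its own factor pairs exactly); full-group criticality
`S_(p)T_(p)^* = S_(p)S_(p)^* = n·K_p`, `0 ⪯ K_p ⪯ I`, `‖T − S_r‖² = n·tr(I − K_p)` and sub-format localisation
`resid ∈ ⊗_p ker(I − K_p)^⊥-complement` (`SketchIdeator1.CriticalGramIdentity` / `SubformatLocalisation`, verified by
all three triagers); `⟨resid, T⟩ = ‖resid‖²` with `T = n³ ∫_{K_T} k·e dk`, so `Σ_α Re⟨resid, k e_α⟩ = d_r` for EVERY
rotated frame (the mass `d_r ≥ 1` cannot be spread thinner than one unit over all frames at once — the claim);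
Kempf–Ness balance of `S_r` under `G_T = GL_n³`. ALIVE sharper forms (each ⇒ S3 with the triad EXHIBITED; triage r1-3):
nodal/OM form "some rotated unit product `t` of `T` has `⟨S_r, t⟩ = 0`" (`min |⟨S*,t⟩| = 0.000000` at `(2,3), (2,4)`),
coverage form "`min_t Re⟨S_r,t⟩ ≤ 0`" (`−0.0039`, `−0.035`). DEAD forms (do not use): PRL/NRL nuclear-duality
(`E_op` not Hermitian at `(2,3)/(2,4)`), Spectral Gap Conjecture on `K_p`, standard-frame deletion currency
(`max_α|⟨E,e_α⟩|² = 0.97…0.30 < 1` from `r = 2` on), `FreeUnitProduct` for ALL `S` beyond `r ≈ 3n − 2`, convexity of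
`r ↦ d_r`.
WHY IT MIGHT FAIL: a near-optimal `S` in the window `[2n² − O(1), R̲)` at `n ≥ 3` with a DIFFUSE residual
(`‖E‖ ≥ 1 > ‖E‖_σ`) — nobody can certify global optima there today (ALS misses Smirnov-type border schemes:
every random-restart scan reports `M(3,20) ≈ 25 < 27`); the top rung at `n ≥ 3` is probably not a deletion
(`R̲(T − e) = R̲(T)` plausible), so the unit must come from an "analog" residual. A refutation of S3 is NOT a
refutation of the crux (`UnitSlope` tolerates re-optimisation slack; the crux tolerates sub-unit increments at slack
rungs). -/
theorem spectralResidual_raw (hcore : Core) :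
    ∀ (n r : ℕ), 2 * n ≤ r → r < algBorderRank (matMulTensor ℂ n n n) →
      ∀ ε : ℝ, 0 < ε → ∃ δ : ℝ, 0 < δ ∧
        ∀ S : Fin n × Fin n → Fin n × Fin n → Fin n × Fin n → ℂ, tensorRank S ≤ r → S ≠ 0 →
          (∀ S' : Fin n × Fin n → Fin n × Fin n → Fin n × Fin n → ℂ, tensorRank S' ≤ r →
            ‖∑ a, ∑ b, ∑ c, S' a b c * matMulTensor ℂ n n n a b c‖ ^ 2 / (∑ a, ∑ b, ∑ c, ‖S' a b c‖ ^ 2) ≤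
              ‖∑ a, ∑ b, ∑ c, S a b c * matMulTensor ℂ n n n a b c‖ ^ 2 / (∑ a, ∑ b, ∑ c, ‖S a b c‖ ^ 2)
                + δ) →
          ∃ x y z : Fin n × Fin n → ℂ, (∑ i, ‖x i‖ ^ 2) = 1 ∧ (∑ i, ‖y i‖ ^ 2) = 1 ∧ (∑ i, ‖z i‖ ^ 2) = 1 ∧
            1 - ε ≤ ‖∑ a, ∑ b, ∑ c, (matMulTensor ℂ n n n a b c -
              (starRingEnd ℂ) (∑ a', ∑ b', ∑ c', S a' b' c' * matMulTensor ℂ n n n a' b' c') /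
                ((∑ a', ∑ b', ∑ c', ‖S a' b' c'‖ ^ 2 : ℝ) : ℂ) * S a b c) * x a * y b * z c‖ ^ 2 :=
  fun n r hw hb => Summit.MatrixMultiplication.MatrixMultiplication.Theorems.LinearDefectLaw.Passage.stub_passage n r fun S h1 h2 h3 h4 =>
    rsl_of_core hcore hw hb S ⟨h1, h2, h3, h4⟩

/-! ### S3 in the line's vocabulary -/

/-- S3 in vocabulary form (conditional on `Core`). -/
theorem spectralResidual (hcore : Core) :
    ∀ (n r : ℕ), 2 * n ≤ r → r < algBorderRank (matMulTensor ℂ n n n) →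
      ∀ ε : ℝ, 0 < ε → ∃ δ : ℝ, 0 < δ ∧
        ∀ S : P n → P n → P n → ℂ, tensorRank S ≤ r → S ≠ 0 →
          (∀ S' : P n → P n → P n → ℂ, tensorRank S' ≤ r → fid S' ≤ fid S + δ) →
          ∃ x y z : P n → ℂ, IsUnitVec x ∧ IsUnitVec y ∧ IsUnitVec z ∧
            1 - ε ≤ ‖triEval (resid S) x y z‖ ^ 2 :=
  spectralResidual_raw hcore

/-! ## The reduction -/

/-- **`LinearDefectLaw` from the three stubs** (concludes the crux decl BY NAME). -/
theorem linearDefectLaw_of_core (hcore : Core) : LinearDefectLaw := by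
  intro n r S hS
  exact linearDefectLaw_of_stubs oneStepGain freeUnitProductDet (spectralResidual hcore) n r S hS

/-- **Registered glue stub `stub_lawOfCore`** (raw form of `linearDefectLaw_of_core`): the open core implies the body of the crux. -/
theorem stub_lawOfCore :
    (∀ (n r : ℕ) (S : Fin n × Fin n → Fin n × Fin n → Fin n × Fin n → ℂ), 2 * n ≤ r → r < algBorderRank (matMulTensor ℂ n n n) → S ∈ closure {S' : Fin n × Fin n → Fin n × Fin n → Fin n × Fin n → ℂ | tensorRank S' ≤ r} → S ≠ 0 → (∑ a, ∑ b, ∑ c, S a b c * matMulTensor ℂ n n n a b c) = ((∑ a, ∑ b, ∑ c, ‖S a b c‖ ^ 2 : ℝ) : ℂ) → (∀ S' : Fin n × Fin n → Fin n × Fin n → Fin n × Fin n → ℂ, tensorRank S' ≤ r → ‖∑ a, ∑ b, ∑ c, S' a b c * matMulTensor ℂ n n n a b c‖ ^ 2 ≤ (∑ a, ∑ b, ∑ c, ‖S a b c‖ ^ 2) * ∑ a, ∑ b, ∑ c, ‖S' a b c‖ ^ 2) → ((∀ a a' : Fin n × Fin n, (∑ b, ∑ c, S a b c * (starRingEnd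 ℂ) (matMulTensor ℂ n n n a' b c)) = ∑ b, ∑ c, S a b c * (starRingEnd ℂ) (S a' b c)) ∧ (∀ b b' : Fin n × Fin n, (∑ a, ∑ c, S a b c * (starRingEnd ℂ) (matMulTensor ℂ n n n a b' c)) = ∑ a, ∑ c, S a b c * (starRingEnd ℂ) (S a b' c)) ∧ (∀ c c' : Fin n × Fin n, (∑ a, ∑ b, S a b c * (starRingEnd ℂ) (matMulTensor ℂ n n n a b c')) = ∑ a, ∑ b, S a b c * (starRingEnd ℂ) (S a b c'))) → ¬ ((∃ u v : Fin n → ℂ, u ≠ 0 ∧ v ≠ 0 ∧ ∀ b c : Fin n × Fin n, (∑ a : Fin n × Fin n, (starRingEnd ℂ) (u a.1) * v a.2 * S a b c) = 0) ∨ (∃ u v : Fin n → ℂ, u ≠ 0 ∧ v ≠ 0 ∧ ∀ a c : Fin n × Fin n, (∑ b : Fin n × Fin n, (starRingEnd ℂ) (u b.1) * v b.2 * S a b c) = 0) ∨ (∃ u v : Fin n → ℂ, u ≠ 0 ∧ v ≠ 0 ∧ ∀ a b : Fin n × Fin n, (∑ c : Fin n × Fin n, (starRingEnd ℂ) (u c.1)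 * v c.2 * S a b c) = 0)) → ∃ x y z : Fin n × Fin n → ℂ, (∑ i, ‖x i‖ ^ 2) = 1 ∧ (∑ i, ‖y i‖ ^ 2) = 1 ∧ (∑ i, ‖z i‖ ^ 2) = 1 ∧ 1 ≤ ‖∑ a, ∑ b, ∑ c, (matMulTensor ℂ n n n a b c - S a b c) * x a * y b * z c‖) → ∀ n r : ℕ, ∀ S : Fin n × Fin n → Fin n × Fin n → Fin n × Fin n → ℂ, tensorRank S ≤ r → ‖∑ a, ∑ b, ∑ c, S a b c * matMulTensor ℂ n n n a b c‖ ^ 2 ≤ ((n : ℝ) ^ 3 + (r : ℝ) - (algBorderRank (matMulTensor ℂ n n n) : ℝ)) * ∑ a, ∑ b, ∑ c, ‖S a b c‖ ^ 2 :=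
  fun h n r S hS => linearDefectLaw_of_core h n r S hS

end Summit.MatrixMultiplication.MatrixMultiplication.Theorems.LinearDefectLaw.Reduction

end
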